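import Summits.Ventures.YMGap.RobustBall.RowsSMassive
import Summits.Ventures.YMGap.RobustBall.AxialPairWitness
import Summits.Ventures.YMGap.RobustBall.AdjointWitness
import HarnessLib

/-!
# Venture YMGap, track ROBUST-BALL (tier 2) — the INFINITE-RANGE axial-pair member: every DLR state is
# MASSIVE (`SU(2)` on `ℤ⁴` at `β_W = 1/16`, `1/20`; all `N ≥ 2` at `β = 1/64`)

HONEST FRAMING. WHAT THIS IS: a venture file (cell `pub-ymgap`, track Y2 ROBUST-BALL, seat ds-3): the MASSIVE
reading of rb-p1's three named rows for the infinite-range member `axialPairWitness N τ (1/10)`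
(`AxialPairWitness.lean`: `SU(N)` Wilson plus ALL axial plaquette-pair couplings
`τ (1/10)^{dist} (Re tr U_p/N)(Re tr U_q/N)`; the member lies in NO tier-1 ball, `not_memBallZd_axialPairWitness`).
Bounding its explicit loads (`memBallZdS_axialPairWitness`) exactly as rb-p1's `AxialPairRows.lean` does, the
seat's tier-2 massive cells (`RowsSMassive.lean`) give: at `β_W = 1/16`, `|τ| ≤ 1/320` the member has DLR states
and EVERY DLR state is an Osterwalder–Seiler MASSIVE STATE (rate `log (3/2)`) with exponentially decaying
plaquette–plaquette correlation function (`su2_axialPair_massive_1_16`); at `β_W = 1/20`, `|τ| ≤ 1/600` the same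
at rate `log 2` (`su2_axialPair_massive_1_20`); for ALL `N ≥ 2` at `SU(N)` coupling `1/64`, `|τ| ≤ 1/420`, rate
`log (6/5)` (`suN_axialPair_massive_1_64`). Door-level, same certificates as rb-p1's rows (exact rationals,
`√N ≥ √2 ≥ 1.41421`). WHAT IT IS NOT: no new number; nothing about the continuum, confinement or the Clay problem.

References: rb-p1 `AxialPairWitness.lean`, `AxialPairRows.lean`, `RowsS.lean`, `RowsSN.lean`; K. Osterwalder,
E. Seiler, Ann. Phys. 110 (1978) 440, §4.
-/

noncomputable section

open MeasureTheory ProbabilityTheory Function Finset Filter Topology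
open scoped NNReal
open Literature.Probability.LatticeModels
open Literature.MathematicalPhysics.QuantumLattice
open Literature.MathematicalPhysics.QuantumFieldTheory hiding ZdEdge
open Literature.Barriers.QuantumFields (IsMassiveState)

namespace Summit.Ventures.YMGap.RobustBall

/-- ★ **The infinite-range axial-pair member at `β_W = 1/16`, `|τ| ≤ 1/320`: every DLR state is MASSIVE**
(rate `log (3/2)`): `SU(2)` on `ℤ⁴` at Wilson coupling `1/16` plus all axial plaquette-pair couplings
`τ (1/10)^{dist} (Re tr U_p/2)(Re tr U_q/2)` has DLR states, and every DLR state is an Osterwalder–Seiler massive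
state with plaquette–plaquette decay — the member lies in the ball of the massive cell
`su2_massiveS_rowS32_1_16` (loads `a ≤ 1/30 ≤ 0.372`, `Λ_{log 3/2} ≤ 0.18302 ≤ 0.186`, as in rb-p1's
`su2_axialPair_massGapS_1_16`). -/
theorem su2_axialPair_massive_1_16 {τ : ℝ} (hτ : |τ| ≤ 1 / 320) :
    (perturbedGibbsMeasuresS (d := 4) (fundamentalRep (Fin 2)) (((2 : ℕ) : ℝ) * ((1 / 16 : ℝ) / 4))
        (axialPairWitness (d := 4) 2 τ (1 / 10))).Nonempty ∧
      ∀ μ ∈ perturbedGibbsMeasuresS (d := 4) (fundamentalRep (Fin 2)) (((2 : ℕ) : ℝ) * ((1 / 16 : ℝ) / 4))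
          (axialPairWitness (d := 4) 2 τ (1 / 10)),
        IsMassiveState μ ∧ HasExponentialDecay (plaquetteCorrFn (fundamentalRep (Fin 2)) μ) := by
  have hq : Real.exp (Real.log (3 / 2)) = 3 / 2 := Real.exp_log (by norm_num)
  have hmem := memBallZdS_axialPairWitness (d := 4) (N := 2) (τ := τ) (κ := 1 / 10) (t := Real.log (3 / 2))
    (by norm_num) (by norm_num) (by norm_num) (by norm_num) (Real.log_nonneg (by norm_num)) (by rw [hq]; norm_num)
  rw [hq] at hmem
  have hs := sqrt_two_ge
  have hs0 : (0 : ℝ) < Real.sqrt 2 := by linarith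
  have hτ0 : 0 ≤ |τ| := abs_nonneg τ
  have hdiv : |τ| / Real.sqrt 2 ≤ (1 / 320) / (141421 / 100000) := div_le_div₀ (by norm_num) hτ (by norm_num) hs
  refine su2_massiveS_rowS32_1_16 (hmem.mono ?_ ?_)
  · push_cast; nlinarith
  · push_cast
    nlinarith [hdiv, div_nonneg hτ0 hs0.le]

/-- **The infinite-range axial-pair member at `β_W = 1/20`, `|τ| ≤ 1/600`: every DLR state is MASSIVE**
(rate `log 2`; massive cell `su2_massiveS_rowS2_1_20`, loads `a ≤ 0.0178 ≤ 0.334`, `Λ_{log 2} ≤ 0.1635 ≤ 0.167`). -/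
theorem su2_axialPair_massive_1_20 {τ : ℝ} (hτ : |τ| ≤ 1 / 600) :
    (perturbedGibbsMeasuresS (d := 4) (fundamentalRep (Fin 2)) (((2 : ℕ) : ℝ) * ((1 / 20 : ℝ) / 4))
        (axialPairWitness (d := 4) 2 τ (1 / 10))).Nonempty ∧
      ∀ μ ∈ perturbedGibbsMeasuresS (d := 4) (fundamentalRep (Fin 2)) (((2 : ℕ) : ℝ) * ((1 / 20 : ℝ) / 4))
          (axialPairWitness (d := 4) 2 τ (1 / 10)),
        IsMassiveState μ ∧ HasExponentialDecay (plaquetteCorrFn (fundamentalRep (Fin 2)) μ) := by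
  have hq : Real.exp (Real.log 2) = 2 := Real.exp_log (by norm_num)
  have hmem := memBallZdS_axialPairWitness (d := 4) (N := 2) (τ := τ) (κ := 1 / 10) (t := Real.log 2)
    (by norm_num) (by norm_num) (by norm_num) (by norm_num) (Real.log_nonneg (by norm_num)) (by rw [hq]; norm_num)
  rw [hq] at hmem
  have hs := sqrt_two_ge
  have hs0 : (0 : ℝ) < Real.sqrt 2 := by linarith
  have hτ0 : 0 ≤ |τ| := abs_nonneg τ
  have hdiv : |τ| / Real.sqrt 2 ≤ (1 / 600) / (141421 / 100000) := div_le_div₀ (by norm_num) hτ (by norm_num) hs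
  refine su2_massiveS_rowS2_1_20 (hmem.mono ?_ ?_)
  · push_cast; nlinarith
  · push_cast
    nlinarith [hdiv, div_nonneg hτ0 hs0.le]

/-- ★ **ALL `N ≥ 2`: the infinite-range axial-pair member at `SU(N)` coupling `1/64`, `|τ| ≤ 1/420`: every DLR
state is MASSIVE** (rate `log (6/5)`; hypothesis-free all-`N` massive cell `suN_massiveS_rowS_1_64`, loads
`a ≤ 0.0254 ≤ 1/20`, `Λ_{log 6/5} ≤ 0.096 ≤ 1/10` using `√N ≥ √2`). -/
theorem suN_axialPair_massive_1_64 {N : ℕ} (hN : 2 ≤ N) {τ : ℝ} (hτ : |τ| ≤ 1 / 420) :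
    (perturbedGibbsMeasuresS (d := 4) (fundamentalRep (Fin N)) ((N : ℝ) * (1 / 64))
        (axialPairWitness (d := 4) N τ (1 / 10))).Nonempty ∧
      ∀ μ ∈ perturbedGibbsMeasuresS (d := 4) (fundamentalRep (Fin N)) ((N : ℝ) * (1 / 64))
          (axialPairWitness (d := 4) N τ (1 / 10)),
        IsMassiveState μ ∧ HasExponentialDecay (plaquetteCorrFn (fundamentalRep (Fin N)) μ) := by
  have hq : Real.exp (Real.log (6 / 5)) = 6 / 5 := Real.exp_log (by norm_num)
  have hmem := memBallZdS_axialPairWitness (d := 4) (N := N) (τ := τ) (κ := 1 / 10) (t := Real.log (6 / 5))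
    (by norm_num) (by omega) (by norm_num) (by norm_num) (Real.log_nonneg (by norm_num)) (by rw [hq]; norm_num)
  rw [hq] at hmem
  have hN2 : (2 : ℝ) ≤ N := by exact_mod_cast hN
  have hs : (141421 / 100000 : ℝ) ≤ Real.sqrt N := sqrt_two_ge.trans (Real.sqrt_le_sqrt hN2)
  have hs0 : (0 : ℝ) < Real.sqrt N := by linarith
  have hτ0 : 0 ≤ |τ| := abs_nonneg τ
  have hdiv : |τ| / Real.sqrt N ≤ (1 / 420) / (141421 / 100000) := div_le_div₀ (by norm_num) hτ (by norm_num) hs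
  refine suN_massiveS_rowS_1_64 hN (hmem.mono ?_ ?_)
  · push_cast; nlinarith
  · push_cast
    nlinarith [hdiv, div_nonneg hτ0 hs0.le]

end Summit.Ventures.YMGap.RobustBall

end
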